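import Summits.Ventures.CertifiedManyBodySolver.Theorems.M3x2EdgeSplitSymReplayOutRoutePF
import HarnessLib

/-!
# SymReplay checker — OUTROUTE closing with a SEMANTICALLY substituted skeleton («H-Sem»): the slot for MERGING enumerators (η, α)

(team lb-sym, cell hub-lb; hub-lb-sym-eng-3 g3.  ADDITIVE on `…OutRouteHS` (hub-lb-sym-eng-4 g2) and `…OutRoutePF`; nothing
landed is touched; crit-1 V172/V176 successor-lever menu: levers (η) word-level factor rows and (α) hash collector.)

WHY.  Every landed closing with a substituted skeleton (`…HS`, `…HSBZ`, `…PS0`, `…PMF0`, `…PMFZ0`, `…PMFP`) asks for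
`(S i).Perm (shareR K κ J i)`: the module's share must be a REORDERING of the specification share.  That fits every enumerator
landed so far (bucketed, keyed, hierarchical, packed-emission — all list-equal or permutations), but NOT the next two levers of
record: (η) merges the coefficients of identical (representative word, basis word) pairs BEFORE emission (E₁: 333 708 239 →
219 486 051 products, hub-lb-sym-eng-3 g3 census j317218) and (α) accumulates in a hash map — both return a polynomial with
the same MEANING and the same WORDS, not the same term list.  The proof of `wardD4CertGe_of_outrouteHS` uses the permutation
exactly twice: words of `S i` lie in the frame (`Perm.mem_iff`), and `polyOp Λ' (S i) = polyOp Λ' (shareR …)` (`polyOp_perm`).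
This file restates the closing with THOSE TWO CONSEQUENCES as the hypotheses — so an η/α module owes only its enumerator and
two lemmas (word inclusion, operator equality), nothing about envelopes, uses or expansions.

CONTENTS.  `wardD4CertGe_of_outrouteHSem` (proof = `…HS` verbatim with the two uses replaced), `energyDensity_ge_of_outrouteHSem`,
the executed-box form `energyDensity_ge_of_outrouteHSemBZ`, and the BARE PACKED form **`energyDensity_ge_of_outroutePSem0`**
(facts `OutFactsP0 lo hi oP S 0 J`, box membership discharged from the word inclusion); the permutation closings are recovered
as the corollary `energyDensity_ge_of_outroutePS0'` (sanity: `Perm` ⇒ both hypotheses).  Standard axioms; no `native_decide`.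

HONEST FRAMING: plumbing theorems composing landed soundness results; no certificate lands by this file; no bound of record
moves (#529 −0.8295699476 outside Lean; tree floor −0.8942613047 computational; stmt-Ventures-22024 met BY VALUE only,
un-landed; stmt-Ventures-21721 open); no summit or crux statement is proved here; nothing here predicts superconductivity.
-/

namespace Summit.Ventures.CertifiedManyBodySolver.Theorems.SymReplay

open Literature.MathematicalPhysics.QuantumLattice
open Literature.MathematicalPhysics.QuantumLattice.HubbardWave0
open Literature.MathematicalPhysics.QuantumLattice.ThermodynamicLimit
open Literature.Probability.LatticeModels
open Literature.MathematicalPhysics.QuantumManyBody.StateRelaxation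
open Summit.Ventures.CertifiedManyBodySolver.Theorems.WardSlot

/-- **HINTED OUTROUTE with a SEMANTICALLY substituted skeleton is sound**: for `i < J`, the words of `S i` occur in
`shareR K κ J i` and `S i` denotes the same operator as `shareR K κ J i` on every window (`polyOp`), + the `J` hinted facts on
`S`.  Verbatim the proof of `wardD4CertGe_of_outrouteHS` (hub-lb-sym-eng-4 g2), whose permutation hypothesis was used only
for these two consequences. -/
theorem wardD4CertGe_of_outrouteHSem (K : SymCertR) (hwf0 : wellFormed K.expand = true)
    (hRok : K.gramR.all (gramBlockROK K.frame) = true) (oracle : Word → HintT) (κ : Word → ℕ) (J : ℕ) (hJ : 0 < J)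
    (S : ℕ → QPoly) (hW : ∀ i, i < J → ∀ t ∈ S i, ∃ t' ∈ shareR K κ J i, t'.2 = t.2)
    (hsem : ∀ (Λ' : Finset (Site 2)) (i : ℕ), i < J → polyOp Λ' (S i) = polyOp Λ' (shareR K κ J i))
    (hfacts : OutFactsHS K oracle S 0 J) :
    WardD4CertGe ((symValueR K : ℚ) : ℝ) := by
  have hwfb : wellFormed K.toSymCert = true := wellFormed_toSymCert_of_expand K hwf0
  have hRok' : ∀ B ∈ K.gramR, gramBlockROK K.frame B = true := List.all_eq_true.1 hRok
  have hsD := supp_of_gramROK K hRok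
  have hQR : ∀ k, PSupp (shareR K κ J k) K.frame.toFinset := fun k => by
    rw [shareR_eq]; exact (PSupp_rawResidualR K hwfb hRok).filter _
  have hQ : ∀ k, k < J → PSupp (S k) K.frame.toFinset := fun k hk t ht => by
    obtain ⟨t', ht', he⟩ := hW k hk t ht
    intro ℓ hℓ
    exact hQR k t' ht' ℓ (he ▸ hℓ)
  have hmap : ∀ Λ' : Finset (Site 2), ((List.range J).map S).map (polyOp Λ') = (sharesR K κ J).map (polyOp Λ') := by
    intro Λ'
    rw [sharesR, List.map_map, List.map_map]
    refine List.map_congr_left fun i hi => ?_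
    exact hsem Λ' i (List.mem_range.mp hi)
  /- the DERIVED use family and its envelope -/
  let U := ((List.range J).map S).flatMap (canonNFZHUses K.frame oracle) ++ (K.gramR.flatMap blockUses).map negUse
  have hL : (envelope K.expand U).toList.toFinset = envelope K.expand U := Finset.toList_toFinset _
  have hFL : K.frame.toFinset ⊆ (envelope K.expand U).toList.toFinset := by
    rw [hL]; exact (subset_thicken _ 1).trans (thicken_subset_envelope K.expand U)
  have hU : ∀ e ∈ U, SuppIn e.u K.expand.frame.toFinset := by
    intro e he
    rcases List.mem_append.1 he with he | he
    · rw [List.mem_flatMap] at he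
      obtain ⟨Q, hQ', he⟩ := he
      rw [List.mem_map] at hQ'
      obtain ⟨k, hk, rfl⟩ := hQ'
      exact canonNFZHUses_supp K.frame oracle _ (hQ k (List.mem_range.mp hk)) e he
    · rw [List.mem_map] at he
      obtain ⟨e', he', rfl⟩ := he
      rw [List.mem_flatMap] at he'
      obtain ⟨B, hB, he'⟩ := he'
      rw [blockUses, List.mem_flatMap] at he'
      obtain ⟨m, -, he'⟩ := he'
      obtain ⟨t, ht, hu⟩ := polyUses_u he'
      show SuppIn e'.u K.frame.toFinset
      rw [hu]
      exact PSupp_gramBlockPolyR B (hsD B hB).1 (hsD B hB).2 t ht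
  refine wardD4CertGe_of_expansion K.expand hwf0 U hU ?_
  /- the expansion -/
  have hBL : ∀ B ∈ K.gramR, (∀ s ∈ B.reps, PSupp (genPre B.moves s) (envelope K.expand U).toList.toFinset) ∧
      ∀ q ∈ genBasis B, ∀ m ∈ B.moves,
        PSupp (movePolyF m.γ m.v q) (envelope K.expand U).toList.toFinset ∧
          isZero (psub (nfPoly (movePolyF m.γ m.v q)) (pscale m.χ q)) = true := fun B hB =>
    ⟨fun s hs => (((gramBlockROK_spec (hRok' B hB)).1 s hs).2).mono hFL,
      fun q hq m hm => ⟨((gramBlockROK_spec (hRok' B hB)).2 q hq m hm).1.mono hFL,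
        ((gramBlockROK_spec (hRok' B hB)).2 q hq m hm).2⟩⟩
  have h2 := polyOp_rhsPoly_expand (envelope K.expand U).toList.toFinset K hBL
  have hsum := sum_outFactsHS K oracle S hFL J hQ J 0 (by omega) hfacts
  rw [← List.range_eq_range'] at hsum
  change (((List.range J).map S).map _).sum =
    ((((List.range J).map S).flatMap (canonNFZHUses K.frame oracle)).map
      (useOp (envelope K.expand U).toList.toFinset)).sum at hsum
  rw [hmap, sum_sharesR K hwfb κ hJ hFL] at hsum
  have hl : lhsPoly K.expand = lhsPoly K.toSymCert := rfl
  have hneg : (((K.gramR.flatMap blockUses).map negUse).map (useOp (envelope K.expand U).toList.toFinset)).sum =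
      -((K.gramR.flatMap blockUses).map (useOp (envelope K.expand U).toList.toFinset)).sum := by
    rw [List.map_map, ← list_sum_map_neg]
    simp only [Function.comp_def, useOp_negUse]
  rw [hl, h2, List.map_append, List.sum_append, hneg, ← hsum]
  abel

/-- Closing theorem, semantically substituted skeleton, frame-list facts. -/
theorem energyDensity_ge_of_outrouteHSem (K : SymCertR) (hwf : wellFormed K.expand = true)
    (hRok : K.gramR.all (gramBlockROK K.frame) = true) (oracle : Word → HintT) (κ : Word → ℕ) (J : ℕ) (hJ : 0 < J)
    (S : ℕ → QPoly) (hW : ∀ i, i < J → ∀ t ∈ S i, ∃ t' ∈ shareR K κ J i, t'.2 = t.2)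
    (hsem : ∀ (Λ' : Finset (Site 2)) (i : ℕ), i < J → polyOp Λ' (S i) = polyOp Λ' (shareR K κ J i))
    (hfacts : OutFactsHS K oracle S 0 J) :
    ((symValueR K : ℚ) : ℝ) ≤ energyDensityTT' 1 0 8 (7 / 8) :=
  energyDensity_ge_of_windowSound_cert _ WardSlot.stub_wardWindowSound
    (wardD4CertGe_of_outrouteHSem K hwf hRok oracle κ J hJ S hW hsem hfacts)

/-- Closing theorem, semantically substituted skeleton, executed box facts. -/
theorem energyDensity_ge_of_outrouteHSemBZ (K : SymCertR) (hwf : wellFormed K.expand = true)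
    (hRok : K.gramR.all (gramBlockROK K.frame) = true) (oracle : Word → HintT) (κ : Word → ℕ) (J : ℕ) (hJ : 0 < J)
    (S : ℕ → QPoly) (hW : ∀ i, i < J → ∀ t ∈ S i, ∃ t' ∈ shareR K κ J i, t'.2 = t.2)
    (hsem : ∀ (Λ' : Finset (Site 2)) (i : ℕ), i < J → polyOp Λ' (S i) = polyOp Λ' (shareR K κ J i))
    (lo hi : ℤ × ℤ) (hbox : boxLicence K.frame lo hi = true) (hfacts : OutFactsHSBZ K oracle S lo hi 0 J) :
    ((symValueR K : ℚ) : ℝ) ≤ energyDensityTT' 1 0 8 (7 / 8) :=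
  energyDensity_ge_of_outrouteHSem K hwf hRok oracle κ J hJ S hW hsem
    (outFactsHS_of_B K oracle S hbox J 0 (outFactsHSB_of_Z K oracle S lo hi J 0 hfacts))

/-- **Closing theorem, semantically substituted skeleton, BARE packed facts** — the slot an η/α module fills:
`hW` (every word of `S i` is a word of `shareR K κ J i`), `hsem` (same operator on every window), and per module
`PackedNF.pisZero (PackedNF.pcanonNFZHBZ lo hi oP (PackedNF.encP lo hi (S i))) = true` (or its packed-emission form). -/
theorem energyDensity_ge_of_outroutePSem0 (K : SymCertR) (hwf : wellFormed K.expand = true)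
    (hRok : K.gramR.all (gramBlockROK K.frame) = true) (oP : PackedNF.PWord → PackedNF.PHint) (κ : Word → ℕ) (J : ℕ)
    (hJ : 0 < J) (S : ℕ → QPoly) (hW : ∀ i, i < J → ∀ t ∈ S i, ∃ t' ∈ shareR K κ J i, t'.2 = t.2)
    (hsem : ∀ (Λ' : Finset (Site 2)) (i : ℕ), i < J → polyOp Λ' (S i) = polyOp Λ' (shareR K κ J i)) (lo hi : ℤ × ℤ)
    (hbox : boxLicence K.frame lo hi = true) (hfacts : OutFactsP0 lo hi oP S 0 J) :
    ((symValueR K : ℚ) : ℝ) ≤ energyDensityTT' 1 0 8 (7 / 8) := by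
  have hwfb : wellFormed K.toSymCert = true := wellFormed_toSymCert_of_expand K hwf
  have hB : ∀ k, k < J → PackedNF.PInB lo hi (S k) := fun k hk => by
    refine PInB_of_PSupp hbox fun t ht => ?_
    have hsh : PSupp (shareR K κ J k) K.frame.toFinset :=
      PSupp_sharesR K hwfb hRok κ J _ (by rw [sharesR, List.mem_map]; exact ⟨k, List.mem_range.2 hk, rfl⟩)
    obtain ⟨t', ht', he⟩ := hW k hk t ht
    intro ℓ hℓ
    exact hsh t' ht' ℓ (he ▸ hℓ)
  exact energyDensity_ge_of_outrouteHSemBZ K hwf hRok (PackedNF.oracleOfP lo hi oP) κ J hJ S hW hsem lo hi hbox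
    (outFactsHSBZ_of_packed0 K lo hi oP S J hB J 0 (by omega) hfacts)

/-- The two semantic hypotheses FOLLOW from a permutation (so every landed `Perm` closing is an instance of `…Sem`). -/
theorem semHyps_of_perm (K : SymCertR) (κ : Word → ℕ) (J : ℕ) (S : ℕ → QPoly)
    (hS : ∀ i, i < J → (S i).Perm (shareR K κ J i)) :
    (∀ i, i < J → ∀ t ∈ S i, ∃ t' ∈ shareR K κ J i, t'.2 = t.2) ∧
      ∀ (Λ' : Finset (Site 2)) (i : ℕ), i < J → polyOp Λ' (S i) = polyOp Λ' (shareR K κ J i) :=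
  ⟨fun i hi t ht => ⟨t, (hS i hi).mem_iff.1 ht, rfl⟩, fun Λ' i hi => polyOp_perm Λ' (hS i hi)⟩

/-- Sanity instance: the bare-packed permutation closing of record (`…PS0`) recovered through the semantic skeleton. -/
theorem energyDensity_ge_of_outroutePS0' (K : SymCertR) (hwf : wellFormed K.expand = true)
    (hRok : K.gramR.all (gramBlockROK K.frame) = true) (oP : PackedNF.PWord → PackedNF.PHint) (κ : Word → ℕ) (J : ℕ)
    (hJ : 0 < J) (S : ℕ → QPoly) (hS : ∀ i, i < J → (S i).Perm (shareR K κ J i)) (lo hi : ℤ × ℤ)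
    (hbox : boxLicence K.frame lo hi = true) (hfacts : OutFactsP0 lo hi oP S 0 J) :
    ((symValueR K : ℚ) : ℝ) ≤ energyDensityTT' 1 0 8 (7 / 8) :=
  energyDensity_ge_of_outroutePSem0 K hwf hRok oP κ J hJ S (semHyps_of_perm K κ J S hS).1 (semHyps_of_perm K κ J S hS).2
    lo hi hbox hfacts

/-- **MERGING IS SEMANTICALLY NEUTRAL** — the lemma an η/α enumerator typically needs for `hsem`: collecting a polynomial
does not change the operator it denotes (re-export of the landed `collect` soundness in `polyOp` form). -/
theorem polyOp_collect_eq (Λ' : Finset (Site 2)) (p : QPoly) : polyOp Λ' (collect p) = polyOp Λ' p := by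
  rw [polyOp_eq_evalP, collect_eval, ← polyOp_eq_evalP]

end Summit.Ventures.CertifiedManyBodySolver.Theorems.SymReplay
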